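import Literature.AlgebraicGeometry.HodgeTheory.NodalPencilPicardLefschetz
import Literature.AlgebraicGeometry.HodgeTheory.PicardLefschetzNodalFormsKeyedShapes
import HarnessLib

/-!
# One-node Picard–Lefschetz data at ANY radius in a monomial pencil direction — UNCONDITIONAL (from prover-Bx's theorem)

Family `hodge`, layer `Literature/AlgebraicGeometry/HodgeTheory`; theorems only.  Written by the prover seat `hodge-nonav-19716-p2` (g10, cell
`hodge-nonav`) for crux K1-B `VeryGeneralSignCommutatorsInHg` (route `HodgeConjecture/SignSymmetricPowers`, stmt-HodgeConjecture-19716), P3 g34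
DECISION (2) 2026-08-29T00:07:12Z: the one-node Picard–Lefschetz binder of K1-B is DISCHARGED in monomial direction by
`NodalPencil.picardLefschetz_oneNode_monomial` (prover-Bx, `NodalPencilPicardLefschetz`, p680592).  This file turns that theorem into the
consumer shape the `A₃` site needs: for ODD fibre dimension and a co-pencil form `g = a·xᵢ^d`, Picard–Lefschetz data on a circle of ANY radius
inside the punctured disc of nonsingular members (data at an infinitesimal radius from the theorem, moved outward by
`IsPicardLefschetzData.exists_of_concentric` along the proved flat coefficient `exists_isFlatCoefficient`, rescaled by `IsFlatCoefficient.const_mul`).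

* `exists_isPicardLefschetzData_of_radius_monomial` — no hypothesis beyond the data (unconditional).

Nothing here says HC is proved.

## References

* [VoisinHodgeII2003] C. Voisin, Hodge Theory and Complex Algebraic Geometry II, CUP 2003: §2.3.1, §3.1.2, §3.2.1 Thm. 3.16, §3.2.2, §3.2.3.
* [Hatcher2002] A. Hatcher, Algebraic Topology, §1.1 Lemma 1.19.
-/

noncomputable section

open CategoryTheory AlgebraicGeometry MvPolynomial
open Literature.AlgebraicTopology.SingularHomology
open Literature.AlgebraicGeometry.Motives Literature.AlgebraicGeometry.Motives.UniversalHypersurface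

namespace Literature.AlgebraicGeometry.HodgeTheory

section HodgeTheory

variable {n d : ℕ}

/-- **One-node Picard–Lefschetz data on a circle of ANY radius inside the punctured disc of nonsingular members** (odd `n`, so the
rider is void), MONOMIAL direction — UNCONDITIONAL: from the THEOREM `NodalPencil.picardLefschetz_oneNode_monomial` (prover-Bx, p680592), data at an
infinitesimal radius with its own coefficient `c₁`; the proved flat coefficient
`cf` (`exists_isFlatCoefficient`) rescaled to `(c₁ / cf(s₁)) · cf` takes the value `c₁` at the inner point, and
`IsPicardLefschetzData.exists_of_concentric` moves the data to radius `r`.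
[cite: VoisinHodgeII2003, §3.2.1 Thm. 3.16, §3.2.2, §3.1.2 and §2.3.1] [cite: Hatcher2002, §1.1 Lemma 1.19 (p. 37)] -/
theorem exists_isPicardLefschetzData_of_radius_monomial (hn : 1 ≤ n) (hd : 1 ≤ d)
    (hodd : Odd n) (hU : IsCohomologicallyLocallyTrivialOn (family ℂ n d) Set.univ) {f₁ g : MvPolynomial (Fin (n + 2)) ℂ}
    (hf₁ : f₁.IsHomogeneous d) (hg : g.IsHomogeneous d) (hgX : ∃ (i : Fin (n + 2)) (a : ℂ), g = a • X i ^ d)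
    {p : Fin (n + 2) → ℂ} (hp : IsNodalFormWithNodes f₁ ![p]) (hgp : eval p g ≠ 0) {r : ℝ} (hr : 0 < r)
    (hJr : ∀ c' : ℂ, c' ≠ 0 → ‖c'‖ ≤ r → SmoothHypersurface.IsNonsingularForm ℂ (f₁ + c' • g))
    {s : ComplexPoints (base ℂ n d)} (hs : pointForm ℂ n d s = f₁ + (r : ℂ) • g) {γ : Path s s}
    (hγ : IsPencilCircle n d f₁ g r γ) :
    ∃ (δ : bettiCohomology (fiberOver (family ℂ n d) s) n) (c : ℚ), IsPicardLefschetzData n d 1 hn hd hU γ ![δ] c := by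
  obtain ⟨i, a, hgi⟩ := hgX
  have H := NodalPencil.picardLefschetz_oneNode_monomial n d hn hd f₁ hf₁ p hp i a (hgi ▸ hgp)
  rw [← hgi] at H
  obtain ⟨ε₀, hε₀, -, hrest⟩ := H
  -- an infinitesimal radius `ε` inside `(0, r]`
  obtain ⟨ε, hε0, hε1, hεr⟩ : ∃ ε : ℝ, 0 < ε ∧ ε < ε₀ ∧ ε ≤ r :=
    ⟨min (ε₀ / 2) r, lt_min (half_pos hε₀) hr, lt_of_le_of_lt (min_le_left _ _) (half_lt_self hε₀),
      min_le_right _ _⟩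
  have hJεr : ∀ c' : ℂ, ‖c'‖ ∈ Set.uIcc r ε → SmoothHypersurface.IsNonsingularForm ℂ (f₁ + c' • g) := by
    intro c' hc'
    rw [Set.uIcc_of_ge hεr] at hc'
    have hne : c' ≠ 0 := fun h0 => by
      rw [h0, norm_zero] at hc'
      exact absurd hc'.1 (not_le.2 hε0)
    exact hJr c' hne hc'.2
  have hJε : ∀ c' : ℂ, ‖c'‖ = |ε| → SmoothHypersurface.IsNonsingularForm ℂ (f₁ + c' • g) := fun c' hc' =>
    hJεr c' (by rw [hc', abs_of_pos hε0, Set.uIcc_of_ge hεr]; exact ⟨le_rfl, hεr⟩)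
  obtain ⟨s₁, hs₁⟩ := exists_point_of_isNonsingularForm ℂ n d (isHomogeneous_add_smul hf₁ hg (ε : ℂ))
    (hJε _ (by rw [Complex.norm_real, Real.norm_eq_abs]))
  obtain ⟨γ₁, hγ₁⟩ := exists_isPencilCircle hf₁ hg hJε s₁ hs₁
  -- Picard–Lefschetz data at radius `ε` (the rider is void for odd `n`)
  obtain ⟨δ₁, c₁, hPL₁⟩ := hrest hU ε hε0 hε1 s₁ hs₁ γ₁ hγ₁ fun he => (Nat.not_even_iff_odd.2 hodd he).elim
  -- the flat coefficient rescaled to take the value `c₁` at `s₁`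
  obtain ⟨cf, hcf⟩ := exists_isFlatCoefficient n d hn hd hU
  have hc₁ : c₁ ≠ 0 := hPL₁.c_ne_zero
  have hκ : c₁ / cf s₁ ≠ 0 := div_ne_zero hc₁ (hcf.1 s₁)
  have hcf' := hcf.const_mul hκ
  have e₁ : c₁ / cf s₁ * cf s₁ = c₁ := div_mul_cancel₀ c₁ (hcf.1 s₁)
  have hPL₁' : IsPicardLefschetzData n d 1 hn hd hU γ₁ ![δ₁] (c₁ / cf s₁ * cf s₁) := by rw [e₁]; exact hPL₁
  obtain ⟨δ', h'⟩ := hPL₁'.exists_of_concentric hcf' hf₁ hg hr.le hε0.le hJεr hs hs₁ hγ hγ₁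
  refine ⟨δ' 0, c₁ / cf s₁ * cf s, ?_⟩
  have e : (![δ' 0] : Fin 1 → bettiCohomology (fiberOver (family ℂ n d) s) n) = δ' := by
    funext i; fin_cases i; rfl
  rw [e]
  exact h'

end HodgeTheory

end Literature.AlgebraicGeometry.HodgeTheory

end
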